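/-
Cell b2b-lgcu-borel (gen 21).  VALUE = THEOREM (a transport lemma making the character-law exclusions
conjugation-invariant), NOT summit progress; the crux item `SubgroupIdentityDesigns` (stmt-14079)
stays open and untouched.
-/
import Mathlib
import Summits.MatrixMultiplication.MatrixMultiplication.Theorems.SubgroupIdentityDesigns.Negative.LevelOneEquivariantDim

/-!
# Conjugation transport for admissible orbits: `ν_{σ^x}(x K x⁻¹) ≤ ν_σ(K)`

Route `LevelGradedCohnUmans`, crux `SubgroupIdentityDesigns` (stmt-MatrixMultiplication-14079); report
`run/shared/lean/b2b/levelgraded-cu/ORACLE-g21.md` §G21-5/(S-c).  VALUE = THEOREM (bookkeeping that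
turns every instance of the character law `CharacterLaw` for a specific subgroup `K ≤ GL_m(𝔽_p)` into
one for all of its conjugates), NOT summit progress; the crux item is untouched and remains open.

For `K ≤ GL_m(𝔽_p)`, a linear character `σ : K → ℂˣ` and `x ∈ GL_m(𝔽_p)` let `K^x = x K x⁻¹`
(`conjSubgroup`, `Subgroup.map (MulAut.conj x)`) and `σ^x (x k x⁻¹) = σ(k)` (`conjChar`, through the
isomorphism `conjEquiv : K ≃* K^x`).  Then

* `conjChar_ne_one` — `σ ≠ 1 ⇒ σ^x ≠ 1`;
* `inv_smul_mem_adm` — `u` admissible for `(K^x, σ^x)` ⇒ `x⁻¹ u` admissible for `(K, σ)`;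
* `card_admOrb_conj_le` — **`ν_{σ^x}(K^x) ≤ ν_σ(K)`** (the map `[u] ↦ [x⁻¹ u]` on admissible orbits
  is injective).

Sorry-free; standard axioms.
-/

set_option linter.dupNamespace false

noncomputable section

open scoped BigOperators Classical Matrix

namespace Summit.MatrixMultiplication.MatrixMultiplication.Theorems.SubgroupIdentityDesigns.Negative
namespace ConjugationTransport

open Summit.MatrixMultiplication.MatrixMultiplication.Theorems.LieRankDesigns.Negative (GLm Mat)
open LevelOneInvariantDim (Ω orb exists_smul_eq_out)
open LevelOneEquivariantDim (adm mem_adm AdmOrb smul_mem_adm exists_ne_one)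

variable {p m : ℕ}

/-- The conjugate subgroup `x K x⁻¹`. -/
abbrev conjSubgroup (K : Subgroup (GLm p m)) (x : GLm p m) : Subgroup (GLm p m) :=
  K.map (MulAut.conj x).toMonoidHom

/-- Elements of `x K x⁻¹`. -/
theorem mem_conjSubgroup {K : Subgroup (GLm p m)} {x g : GLm p m} :
    g ∈ conjSubgroup K x ↔ ∃ k ∈ K, x * k * x⁻¹ = g := by
  simp only [conjSubgroup, Subgroup.mem_map, MulEquiv.coe_toMonoidHom, MulAut.conj_apply]

/-- The isomorphism `K ≃* x K x⁻¹`, `k ↦ x k x⁻¹`. -/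
def conjEquiv (K : Subgroup (GLm p m)) (x : GLm p m) : K ≃* conjSubgroup K x :=
  K.equivMapOfInjective (MulAut.conj x).toMonoidHom (MulAut.conj x).injective

/-- `conjEquiv K x k = x k x⁻¹`. -/
theorem coe_conjEquiv (K : Subgroup (GLm p m)) (x : GLm p m) (k : K) :
    ((conjEquiv K x k : conjSubgroup K x) : GLm p m) = x * k * x⁻¹ := rfl

/-- The transported character `σ^x (x k x⁻¹) = σ(k)`. -/
def conjChar (K : Subgroup (GLm p m)) (σ : K →* ℂˣ) (x : GLm p m) : conjSubgroup K x →* ℂˣ :=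
  σ.comp (conjEquiv K x).symm.toMonoidHom

/-- `σ^x (x k x⁻¹) = σ(k)`. -/
theorem conjChar_apply (K : Subgroup (GLm p m)) (σ : K →* ℂˣ) (x : GLm p m) (k : K) :
    conjChar K σ x (conjEquiv K x k) = σ k := by
  simp [conjChar]

/-- `(x k x⁻¹) u = x (k (x⁻¹ u))`. -/
theorem conjEquiv_smul (K : Subgroup (GLm p m)) (x : GLm p m) (k : K) (u : Fin m → ZMod p) :
    (conjEquiv K x k : conjSubgroup K x) • u = x • (k • (x⁻¹ • u)) := by
  show ((conjEquiv K x k : conjSubgroup K x) : GLm p m) • u = x • ((k : GLm p m) • (x⁻¹ • u))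
  rw [coe_conjEquiv, mul_smul, mul_smul]

/-- `σ ≠ 1 ⇒ σ^x ≠ 1`. -/
theorem conjChar_ne_one {K : Subgroup (GLm p m)} {σ : K →* ℂˣ} (hσ : σ ≠ 1) (x : GLm p m) :
    conjChar K σ x ≠ 1 := by
  obtain ⟨k, hk⟩ := exists_ne_one hσ
  intro h1
  apply hk
  rw [← conjChar_apply K σ x k, h1, MonoidHom.one_apply]

variable [hp : Fact p.Prime]

/-- Admissibility transports: `u` admissible for `(x K x⁻¹, σ^x)` ⇒ `x⁻¹ u` admissible for `(K, σ)`. -/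
theorem inv_smul_mem_adm {K : Subgroup (GLm p m)} {σ : K →* ℂˣ} {x : GLm p m} {u : Fin m → ZMod p}
    (hu : u ∈ adm (conjSubgroup K x) (conjChar K σ x)) : x⁻¹ • u ∈ adm K σ := by
  intro k hk
  have hfix : (conjEquiv K x k : conjSubgroup K x) • u = u := by
    rw [conjEquiv_smul, hk, smul_inv_smul]
  rw [← conjChar_apply K σ x k]
  exact hu _ hfix

/-- **`ν_{σ^x}(x K x⁻¹) ≤ ν_σ(K)`.** -/
theorem card_admOrb_conj_le (K : Subgroup (GLm p m)) (σ : K →* ℂˣ) (x : GLm p m) :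
    Nat.card (AdmOrb (conjSubgroup K x) (conjChar K σ x)) ≤ Nat.card (AdmOrb K σ) := by
  have hrep : ∀ ω : AdmOrb (conjSubgroup K x) (conjChar K σ x),
      (orb K (x⁻¹ • ω.1.out)).out ∈ adm K σ := fun ω => by
    obtain ⟨k, hk⟩ := exists_smul_eq_out K (x⁻¹ • ω.1.out)
    rw [← hk]
    exact smul_mem_adm K σ k (inv_smul_mem_adm ω.2)
  let ι : AdmOrb (conjSubgroup K x) (conjChar K σ x) → AdmOrb K σ :=
    fun ω => ⟨orb K (x⁻¹ • ω.1.out), hrep ω⟩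
  refine Nat.card_le_card_of_injective ι fun ω ω' he => ?_
  have he' : orb K (x⁻¹ • ω.1.out) = orb K (x⁻¹ • ω'.1.out) := congrArg Subtype.val he
  obtain ⟨k, hk⟩ : ∃ k : K, k • (x⁻¹ • ω'.1.out) = x⁻¹ • ω.1.out :=
    MulAction.mem_orbit_iff.1 (MulAction.orbitRel_apply.1 (Quotient.exact he'))
  have hk' : (conjEquiv K x k : conjSubgroup K x) • ω'.1.out = ω.1.out := by
    rw [conjEquiv_smul, hk, smul_inv_smul]
  apply Subtype.ext
  rw [← Quotient.out_eq ω.1, ← Quotient.out_eq ω'.1]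
  exact Quotient.sound (MulAction.orbitRel_apply.2 (MulAction.mem_orbit_iff.2 ⟨_, hk'⟩))

end ConjugationTransport
end Summit.MatrixMultiplication.MatrixMultiplication.Theorems.SubgroupIdentityDesigns.Negative
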